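import Literature.IUT.LogVolume.ExplicitEstimatesFermatLowerBound
import Literature.Barriers.ABC.IUTDisputedClaimProofs
import HarnessLib

/-!
# [ExpEst] Corollary 5.8 ("Fermat's Last Theorem" for prime exponents `> 1.615·10^14`) from the DISPUTED Theorem B — the implication, PROVED

S. Mochizuki, I. Fesenko, Y. Hoshi, A. Minamide, W. Porowski, *Explicit estimates in inter-universal
Teichmüller theory*, Kodai Math. J. **45** (2022) 175–236 (= [ExpEst]), §5, **Corollary 5.8** (p. 230) with its
proof (pp. 230–231) (= Corollary C of the Introduction, p. 179; render
`plan/repair/lit/renders/MFHMP-ExplicitEstimates-Kodai2022-book-anonnd-eeiutp`, pdf p. 56 l.23 – p. 57 l.37;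
pdf page = journal page − 174).

**As printed.** "Corollary 5.8 (Application to "Fermat's Last Theorem"). Let `p > 1.615·10^14` be a prime
number. Then there does not exist any triple `(x, y, z)` of positive integers that satisfies the Fermat equation
`x^p + y^p = z^p`." Its printed proof applies Theorem 5.3 (ii) at `L = ℚ`, `(a, b, c) = (x^p, y^p, −z^p)`, `ε = 1`,
together with Lemma 5.7.

HONEST FRAMING. Theorem 5.3/Theorem B of [ExpEst] depend on [IUTchIII] Cor. 3.12, whose proof is DISPUTED
(catalogued record-only as `Literature.Barriers.ABC.IUTDisputedClaim`, `@[conjecture]`,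
[claim: MochizukiEtAl2022, status: disputed]). This file asserts NONE of them. It PROVES the IMPLICATION
`IUTDisputedClaim → (∀ prime p > 1.615·10^14, FermatLastTheoremFor p)` (`cor58_of_IUTDisputedClaim`), i.e. it
makes kernel-precise what the disputed explicit inequality would buy here; Fermat's Last Theorem itself is a
theorem of Wiles–Taylor–Wiles (not in the tree; Mathlib states it as `FermatLastTheorem`). typed ≠ proved ≠
endorsed; no side is taken on [IUTchIII] Cor. 3.12.

**Kernel route** (print in brackets). Reduce to a primitive triple [p. 230 "we may assume without loss of
generality that `x, y, z` are coprime"] by Mathlib's `fermatLastTheoremWith_of_fermatLastTheoremWith_coprime`;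
Lemma 5.7 (`ExpEst.lemma57`, file `ExplicitEstimatesFermatLowerBound.lean`) gives `2z > (p+1)^p`; Theorem A (ii)
over `ℚ` in the integer form DERIVED IN THE TREE from Theorem B (`IUTDisputedClaim.max_abs_le_thmA`,
`IUTDisputedClaimProofs.lean`) gives [p. 231, first display] `z^p ≤ 2^{5/2}·max{exp(¼·h₁(1)), rad^3}` with
`h₁(1) = 3.4·10^30` and `rad = rad(x^p y^p z^p) = rad(xyz) ≤ xyz ≤ z^3` [print: "`≤ (xyz)^3 ≤ (z^3)^3`"]. Print then
combines into `(p − 9)(−1 + p·log₂(p+1)) < 5/2 + log₂(e)·¼·h₁(1) < 1.227·10^30` and contradicts it for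
`p > 1.615·10^14` via `1/log 2 > 1.44`; the kernel splits the `max` instead: the radical branch `z^p ≤ 2^{5/2} z^9`
is absurd for `z ≥ 2`, `p ≥ 12` (`2^{5/2} < 8 ≤ z^3`); the exponential branch gives
`p·log z ≤ (5/2)·log 2 + 8.5·10^29` while Lemma 5.7 gives `log z > p·log(p+1) − log 2` with `log(p+1) ≥ 32.7`
(`exp_le_fermatBound`: `e^{32.7} ≤ 1.615·10^14`), so `p·log z > p(32.7p − 0.6932) ≥ 1.615·10^14 · 5.28·10^15 >
8.5·10^29 + 1.733` — contradiction. Same threshold `1.615·10^14` as printed; no constant of the paper is changed.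

Deliberately NOT here: Remarks 5.7.1–5.8.3 (Inkeri / Mihăilescu–Rassias sharpenings, Coppersmith, Vandiver:
other sources), Corollary 5.9 (typed by gen 0 as the candidate `ExpEst.Cor59`, `ExplicitEstimatesTheorem53.lean`),
and any link to the number-field predicate `ExpEst.Thm53ii` (whose `ℚ`-instance would need the identification of
Mathlib's `Height.mulHeight`/`radL` with `max |·|`/`rad` for integers; the tree's integer form of Theorem A (ii)
is used instead). No definition and no named fact is introduced.

## References
* [MochizukiEtAl2022] Kodai Math. J. 45 (2022), Cor. 5.8 (pp. 230–231), Theorem B / Thm. 5.4 [claim key,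
  status disputed, D-0012].
* [ScholzeStix2018] P. Scholze, J. Stix, *Why abc is still a conjecture* (the dissent on [IUTchIII] Cor. 3.12;
  see `Literature/Barriers/ABC/IUTDisputedClaim.lean`).
-/

namespace Literature.IUT.LogVolume

namespace ExpEst

variable {p : ℕ}

/-- `x < z` for a Fermat triple with `y > 0`. [folklore] -/
private theorem lt_of_fermat {x y z : ℕ} (hy : 0 < y) (heq : x ^ p + y ^ p = z ^ p) : x < z := by
  have : 0 < y ^ p := pow_pos hy p
  exact lt_of_pow_lt_pow_left₀ p (Nat.zero_le z) (by omega)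

/-! ### Corollary 5.8 -/

section Cor58

open Real UniqueFactorizationMonoid Literature.Barriers.ABC

/-- `log(1.615·10^14) ≥ 32.7` (certified as `e^33 ≤ 2.7182818286^33 ≤ 1.615·10^14 · 1.331 ≤ 1.615·10^14 · e^{0.3}`).
[claim: MochizukiEtAl2022, status: disputed] -/
private theorem exp_le_fermatBound : Real.exp (32.7 : ℝ) ≤ 1.615e14 := by
  have h01 : (1.1 : ℝ) ≤ Real.exp 0.1 := by
    have := Real.add_one_le_exp (0.1 : ℝ); norm_num at this ⊢; exact this
  have h03 : (1.331 : ℝ) ≤ Real.exp 0.3 := by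
    have e : Real.exp 0.3 = Real.exp 0.1 ^ 3 := by rw [← Real.exp_nat_mul]; norm_num
    rw [e]
    calc (1.331 : ℝ) = 1.1 ^ 3 := by norm_num
      _ ≤ Real.exp 0.1 ^ 3 := pow_le_pow_left₀ (by norm_num) h01 3
  have h33 : Real.exp 32.7 * Real.exp 0.3 ≤ 1.615e14 * 1.331 := by
    rw [← Real.exp_add]
    have e : (32.7 : ℝ) + 0.3 = (33 : ℕ) * 1 := by norm_num
    rw [e, Real.exp_nat_mul]
    calc Real.exp 1 ^ 33 ≤ (2.7182818286 : ℝ) ^ 33 :=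
          pow_le_pow_left₀ (Real.exp_pos 1).le Real.exp_one_lt_d9.le 33
      _ ≤ 1.615e14 * 1.331 := by norm_num
  by_contra hlt
  push Not at hlt
  have : 1.615e14 * Real.exp 0.3 < Real.exp 32.7 * Real.exp 0.3 :=
    mul_lt_mul_of_pos_right hlt (Real.exp_pos _)
  nlinarith [Real.exp_pos (0.3 : ℝ)]

/-- **[ExpEst] Corollary 5.8 (Application to "Fermat's Last Theorem"), conditional form** (p. 230): "Let
`p > 1.615·10^14` be a prime number. Then there does not exist any triple `(x, y, z)` of positive integers that
satisfies the Fermat equation `x^p + y^p = z^p`" — PROVED in the kernel FROM the disputed explicit inequality,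
taken BY NAME as the hypothesis `H : IUTDisputedClaim` (= [ExpEst] Theorem B, `Literature/Barriers/ABC/`,
`@[conjecture]`, [claim: MochizukiEtAl2022, status: disputed]; its proof depends on [IUTchIII] Cor. 3.12).
The conclusion is Mathlib's `FermatLastTheoremFor p`. Route (as printed, p. 230–231, with Theorem 5.3 (ii)
at `L = ℚ`, `(a, b, c) = (x^p, y^p, −z^p)`, `ε = 1` supplied by the tree's
`IUTDisputedClaim.max_abs_le_thmA`): reduce to a primitive triple (Mathlib
`fermatLastTheoremWith_of_fermatLastTheoremWith_coprime`); Lemma 5.7 gives `2z > (p+1)^p`; Theorem A (ii)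
gives `z^p ≤ 2^{5/2}·max{exp(¼·h₁(1)), rad(x^p y^p z^p)^3}` with `rad ≤ xyz ≤ z^3`; the kernel splits the
`max` (print combines both branches into `(p − 9)(−1 + p·log₂(p+1)) < 1.227·10^30`): the radical branch
gives `z^{p−9} ≤ 2^{5/2} < 8`, absurd for `z ≥ 2`, `p ≥ 12`; the exponential branch gives
`p·(p·log(p+1) − log 2) < (5/2)·log 2 + 8.5·10^29`, absurd for `p ≥ 1.615·10^14` since then
`log(p+1) ≥ 32.7` (`exp_le_fermatBound`; print uses `1/log 2 > 1.44` and the same threshold). NOTHING here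
asserts `IUTDisputedClaim`; unconditionally, FLT for all exponents is Wiles's theorem (not in the tree).
[claim: MochizukiEtAl2022, status: disputed] -/
theorem cor58_of_IUTDisputedClaim (H : IUTDisputedClaim) {p : ℕ} (hp : p.Prime)
    (hbig : (1.615e14 : ℝ) < p) : FermatLastTheoremFor p := by
  have hp3r : (3 : ℝ) ≤ p := by linarith
  have hp3 : 3 ≤ p := by exact_mod_cast hp3r
  have hp12 : 12 ≤ p := by
    have : (12 : ℝ) ≤ p := by linarith
    exact_mod_cast this
  rw [fermatLastTheoremFor_iff_nat]
  refine fermatLastTheoremWith_of_fermatLastTheoremWith_coprime fun x y z hx hy hz hgcd heq => ?_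
  exfalso
  have hxpos : 0 < x := Nat.pos_of_ne_zero hx
  have hypos : 0 < y := Nat.pos_of_ne_zero hy
  have hzpos : 0 < z := Nat.pos_of_ne_zero hz
  -- the triple is pairwise coprime
  have hxy : Nat.Coprime x y := by
    refine Nat.coprime_of_dvd fun l hl hlx hly => ?_
    have hlz : l ∣ z := hl.dvd_of_dvd_pow (n := p)
      (by rw [← heq]; exact dvd_add (dvd_pow hlx hp.ne_zero) (dvd_pow hly hp.ne_zero))
    have : l ∣ ({x, y, z} : Finset ℕ).gcd id := Finset.dvd_gcd_iff.mpr (by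
      intro b hb
      simp only [Finset.mem_insert, Finset.mem_singleton] at hb
      rcases hb with rfl | rfl | rfl <;> simpa)
    rw [hgcd] at this
    exact hl.ne_one (Nat.dvd_one.mp this)
  -- Lemma 5.7
  have h57 := lemma57 hp hp3 hxpos hypos hxy heq
  have hxz : x < z := lt_of_fermat hypos heq
  have hyz : y < z := lt_of_fermat hxpos (by rw [add_comm]; exact heq)
  have hz2 : 2 ≤ z := by omega
  -- Theorem A (ii) over `ℚ` (from `H`) at `(x^p, y^p, −z^p)`, `ε = 1`
  have ha : ((x ^ p : ℕ) : ℤ) ≠ 0 := by exact_mod_cast pow_ne_zero p hx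
  have hb : ((y ^ p : ℕ) : ℤ) ≠ 0 := by exact_mod_cast pow_ne_zero p hy
  have hc : -((z ^ p : ℕ) : ℤ) ≠ 0 := by
    rw [neg_ne_zero]; exact_mod_cast pow_ne_zero p hz
  have hg : Int.gcd ((x ^ p : ℕ) : ℤ) ((y ^ p : ℕ) : ℤ) = 1 := by
    rw [Int.gcd_natCast_natCast]; exact Nat.Coprime.pow p p hxy
  have hsum : ((x ^ p : ℕ) : ℤ) + ((y ^ p : ℕ) : ℤ) + -((z ^ p : ℕ) : ℤ) = 0 := by
    have : ((x ^ p + y ^ p : ℕ) : ℤ) = (z ^ p : ℕ) := by exact_mod_cast heq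
    push_cast at this ⊢; linarith
  have key := H.max_abs_le_thmA ha hb hc hg hsum (ε := 1) one_pos le_rfl
  -- simplify the right-hand side
  rw [Real.one_rpow, mul_one] at key
  have h3 : (3 * (1 + 1) / 2 : ℝ) = ((3 : ℕ) : ℝ) := by norm_num
  rw [h3, Real.rpow_natCast] at key
  -- the left-hand side dominates `z^p`
  have hzp : ((z : ℝ)) ^ p ≤ (max (max |(((x ^ p : ℕ) : ℤ) : ℝ)| |(((y ^ p : ℕ) : ℤ) : ℝ)|)
      |((-((z ^ p : ℕ) : ℤ) : ℤ) : ℝ)|) := by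
    have : |((-((z ^ p : ℕ) : ℤ) : ℤ) : ℝ)| = (z : ℝ) ^ p := by push_cast; rw [abs_neg, abs_pow, abs_of_nonneg (by positivity)]
    rw [← this]; exact le_max_right _ _
  -- the radical: `rad(x^p y^p (−z^p)) ≤ xyz ≤ z^3`
  set r : ℤ := radical (((x ^ p : ℕ) : ℤ) * ((y ^ p : ℕ) : ℤ) * -((z ^ p : ℕ) : ℤ)) with hr
  have hr_le : (r : ℝ) ≤ (z : ℝ) ^ 3 := by
    have hprod : ((x ^ p : ℕ) : ℤ) * ((y ^ p : ℕ) : ℤ) * -((z ^ p : ℕ) : ℤ) = -(((x * y * z : ℕ) : ℤ) ^ p) := by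
      push_cast; ring
    have hrad : r = radical ((x * y * z : ℕ) : ℤ) := by
      rw [hr, hprod, UniqueFactorizationDomain.radical_neg, radical_pow _ hp.ne_zero]
    have hxyz : (0 : ℤ) < ((x * y * z : ℕ) : ℤ) := by exact_mod_cast Nat.mul_pos (Nat.mul_pos hxpos hypos) hzpos
    have hle : r ≤ ((x * y * z : ℕ) : ℤ) := by
      rw [hrad]; exact Int.le_of_dvd hxyz radical_dvd_self
    have hle' : (r : ℝ) ≤ ((x * y * z : ℕ) : ℝ) := by exact_mod_cast hle
    have hxyz3 : ((x * y * z : ℕ) : ℝ) ≤ (z : ℝ) ^ 3 := by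
      have : x * y * z ≤ z * z * z := Nat.mul_le_mul (Nat.mul_le_mul hxz.le hyz.le) le_rfl
      calc ((x * y * z : ℕ) : ℝ) ≤ ((z * z * z : ℕ) : ℝ) := by exact_mod_cast this
        _ = (z : ℝ) ^ 3 := by push_cast; ring
    linarith
  have hr0 : (0 : ℝ) ≤ r := by rw [hr]; exact_mod_cast (Int.radical_pos _).le
  -- constants
  set C : ℝ := (2 : ℝ) ^ ((5 : ℝ) / 2) with hC
  have hC0 : 0 ≤ C := by rw [hC]; positivity
  have hC8 : C < 8 := by
    refine lt_of_pow_lt_pow_left₀ 2 (by norm_num) ?_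
    rw [hC, two_rpow_five_halves_sq]; norm_num
  set E : ℝ := Real.exp (1 / 4 * 3.4e30) with hE
  have hzR : (0 : ℝ) < z := by exact_mod_cast hzpos
  -- combine
  have hmain : (z : ℝ) ^ p ≤ C * max E ((r : ℝ) ^ 3) := le_trans hzp key
  rcases le_total E ((r : ℝ) ^ 3) with hER | hRE
  · -- radical branch: `z^p ≤ C·r³ ≤ C·z⁹ < 8·z⁹ ≤ z^{12} ≤ z^p`
    rw [max_eq_right hER] at hmain
    have h1 : (r : ℝ) ^ 3 ≤ ((z : ℝ) ^ 3) ^ 3 := pow_le_pow_left₀ hr0 hr_le 3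
    have h2 : (z : ℝ) ^ p ≤ C * (z : ℝ) ^ 9 := by nlinarith
    have hz9 : (0 : ℝ) < (z : ℝ) ^ 9 := by positivity
    have h3 : (8 : ℝ) * (z : ℝ) ^ 9 ≤ (z : ℝ) ^ 12 := by
      have hz3 : (8 : ℝ) ≤ (z : ℝ) ^ 3 := by
        have : (2 : ℝ) ≤ z := by exact_mod_cast hz2
        calc (8 : ℝ) = 2 ^ 3 := by norm_num
          _ ≤ (z : ℝ) ^ 3 := pow_le_pow_left₀ (by norm_num) this 3
      nlinarith
    have h4 : (z : ℝ) ^ 12 ≤ (z : ℝ) ^ p := pow_le_pow_right₀ (by exact_mod_cast hzpos) hp12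
    nlinarith
  · -- exponential branch: take logarithms
    rw [max_eq_left hRE] at hmain
    have hzp0 : (0 : ℝ) < (z : ℝ) ^ p := by positivity
    have hlog1 : (p : ℝ) * Real.log z ≤ 5 / 2 * Real.log 2 + 1 / 4 * 3.4e30 := by
      have := Real.log_le_log hzp0 hmain
      rw [Real.log_pow, Real.log_mul (by rw [hC]; positivity) (Real.exp_pos _).ne', Real.log_exp, hC,
        Real.log_rpow (by norm_num)] at this
      exact this
    -- from Lemma 5.7: `p·log(p+1) < log 2 + log z`
    have hlog2 : (p : ℝ) * Real.log ((p : ℝ) + 1) < Real.log 2 + Real.log z := by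
      have h : ((p : ℝ) + 1) ^ p < 2 * z := by exact_mod_cast h57
      have h0 : (0 : ℝ) < ((p : ℝ) + 1) ^ p := by positivity
      have := Real.log_lt_log h0 h
      rw [Real.log_pow, Real.log_mul (by norm_num) hzR.ne'] at this
      exact this
    -- `log(p+1) ≥ 32.7`
    have hL : (32.7 : ℝ) ≤ Real.log ((p : ℝ) + 1) := by
      rw [Real.le_log_iff_exp_le (by positivity)]
      linarith [exp_le_fermatBound]
    have hl2 : Real.log 2 < 0.6932 := Real.log_two_lt_d9.trans (by norm_num)
    have hp0 : (0 : ℝ) < p := by linarith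
    -- `p·log z > p·(32.7·p − 0.6932) ≥ 1.615e14 · 5.28e15`
    have hW : 32.7 * (p : ℝ) - 0.6932 ≤ (p : ℝ) * Real.log ((p : ℝ) + 1) - Real.log 2 := by
      nlinarith
    have hA : (5.28e15 : ℝ) ≤ 32.7 * (p : ℝ) - 0.6932 := by linarith
    have hB : (1.615e14 : ℝ) * 5.28e15 ≤ (p : ℝ) * (32.7 * (p : ℝ) - 0.6932) :=
      mul_le_mul hbig.le hA (by norm_num) hp0.le
    have hD : (p : ℝ) * ((p : ℝ) * Real.log ((p : ℝ) + 1) - Real.log 2) < (p : ℝ) * Real.log z := by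
      have := mul_lt_mul_of_pos_left hlog2 hp0
      linarith
    have hE' : (p : ℝ) * (32.7 * (p : ℝ) - 0.6932) ≤ (p : ℝ) * ((p : ℝ) * Real.log ((p : ℝ) + 1) - Real.log 2) :=
      mul_le_mul_of_nonneg_left hW hp0.le
    nlinarith

end Cor58


end ExpEst

end Literature.IUT.LogVolume
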